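import Summits.QuantumFields.YangMills.Theses.OnsetTautology
import HarnessLib

/-!
# Route `OnsetTautology`, glue `PointwiseCalibrationGlue` (stmt-QuantumFields-23812) — BY NAME

Planner ym-idea-11 g11, LINE 1 «SpectralCone» (glued split of `AtomicCalibrationR`, stmt-QuantumFields-28169):
`SpectralCone → ConeReverseSmearing → PointwiseOnsetCalibration → AtomicCalibrationR`.  Definitional: given the
pointwise engine `PointwiseOnsetCalibration : SpectralCone → ConeReverseSmearing → AtomicSqrtDominationR →
ComparableFloors → OnsetContraction → leaf`, the engine node `AtomicCalibrationR : AtomicSynthesis →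
AtomicSqrtDominationR → ComparableFloors → OnsetContraction → leaf` follows by ignoring its `AtomicSynthesis`
hypothesis.  Width seat ym-line-sfw-p2-w2 g24 (cell ym-idea-1; free hands).  HONEST FRAMING: glue only —
`SpectralCone`, `ConeReverseSmearing` and the engine remain OPEN; no crux, leaf, rung or summit is proved; the
Yang–Mills mass gap is NOT proved. [folklore]
-/

set_option autoImplicit false

namespace Summit.QuantumFields.YangMills.Theorems

/-- **`OnsetTautology.PointwiseCalibrationGlue`** (stmt-QuantumFields-23812): the pointwise engine discharges the
engine node `AtomicCalibrationR` with its `AtomicSynthesis` hypothesis unused. [folklore] -/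
theorem onsetTautology_pointwiseCalibrationGlue :
    Summit.QuantumFields.YangMills.Theses.OnsetTautology.PointwiseCalibrationGlue :=
  fun hK hRS hCal _hA hB hR hC => hCal hK hRS hB hR hC

end Summit.QuantumFields.YangMills.Theorems
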